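import Literature.Probability.LatticeModels.LupuCouplingWeights
import Literature.Probability.LatticeModels.DiscreteGFFDirichletField
import Literature.Probability.LatticeModels.ProdBernoulliIndependence
import Literature.Probability.LatticeModels.ProdBernoulliClusterLocality
import Literature.Probability.Percolation.LongRangeKernelPercolationProofs
import HarnessLib

/-!
# Lupu's coupling in finite volume I: clusters inside `Λ` and flipping a cluster

Topic `Literature/Probability/LatticeModels`. Brick 6a of the proof of
`Literature.Probability.LatticeModels.Lupu2016_cableSignClustersBounded` (Lupu 2016, Prop. 5.5):
the combinatorial / product-measure half of the finite-volume coin structure of Lupu's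
Thm. 1 bis. Clusters are formed by the open edges of `ℤ^d` inside a finite `Λ` (`clusterWithin`),
so that all events are cylinder events over the finite edge set `ℰ_Λ`. Contents (all proved):

* `clusterEq_eq_inter` — `{C^Λ_x = S} = {S internally connected from x} ∩ {∂S closed}`
  (`innerConnFrom`, `bdClosed`; first-exit-edge argument), the two events depending on disjoint
  edge sets, whence `P_p(C_x = S) = P_p(innerConnFrom) · ∏_{e ∈ ∂S}(1 - p_e)`
  (`prodBernoulli_real_clusterEq`) for every product measure;
* `prodBernoulli_real_clusterEq_setFlip_mul_exp` — **flipping a cluster**: for Lupu's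
  symmetric weights `symWeight ψ` and `ψ` vanishing off `Λ`,
  `P_{R_S ψ}(C_x = S) · exp(-2 flipExponent S ψ) = P_ψ(C_x = S)` (the inner factor is invariant,
  the boundary factor is `prod_one_sub_symWeight_setFlip_mul_exp`). With the Gaussian change of
  variables `integral_comp_setFlip` this is "conditional on the clusters the signs are i.i.d. fair
  coins" (Lupu 2016, Thm. 1 bis, proof of Prop. 4.2) in finite volume; the expectation identities
  are drawn in `LupuCouplingFiniteVolume.lean`.

References: T. Lupu, Ann. Probab. 44 (2016), Thm. 1 bis, Lemma 4.1, Prop. 4.2 [`Lupu2016`];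
product-measure toolkit `ProdBernoulliIndependence.lean`, `LongRangeKernelPercolationProofs.lean`.
-/

noncomputable section

namespace Literature.Probability.LatticeModels

open _root_.MeasureTheory _root_.ProbabilityTheory Finset Filter Literature.Probability.Percolation
open scoped ENNReal NNReal

variable {d : ℕ}

/-! ### Clusters using the edges inside `Λ` -/

/-- The cluster of `x` in `ω` using only the (open) edges of `ℤ^d` inside `Λ`. [folklore] -/
def clusterWithin (Λ : Finset (Site d)) (ω : Set (Sym2 (Site d))) (x : Site d) : Set (Site d) :=
  openCluster (ω ∩ ↑(edgesIn (zdGraph d) Λ)) x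

/-- The event `{x ↔ y in Λ}`: `y` lies in the cluster of `x` formed by the edges inside `Λ`.
[folklore] -/
def connWithin (Λ : Finset (Site d)) (x y : Site d) : Set (Set (Sym2 (Site d))) :=
  {ω | y ∈ clusterWithin Λ ω x}

/-- The event `{C^Λ_x = S}`. [folklore] -/
def clusterEq (Λ S : Finset (Site d)) (x : Site d) : Set (Set (Sym2 (Site d))) :=
  {ω | clusterWithin Λ ω x = ↑S}

/-- The event "`S` is connected from `x` by open edges with both endpoints in `S`". [folklore] -/
def innerConnFrom (S : Finset (Site d)) (x : Site d) : Set (Set (Sym2 (Site d))) :=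
  {ω | (↑S : Set (Site d)) ⊆ openCluster (ω ∩ ↑(edgesIn (zdGraph d) S)) x}

/-- The event "all boundary edges of `S` inside `Λ` are closed". [folklore] -/
def bdClosed (Λ S : Finset (Site d)) : Set (Set (Sym2 (Site d))) :=
  {ω | ∀ e ∈ bdEdges Λ S, e ∉ ω}

/-- A vertex joined to `x` by edges inside `Λ` is `x` or lies in `Λ`. [folklore] -/
theorem clusterWithin_subset (Λ : Finset (Site d)) (ω : Set (Sym2 (Site d))) (x : Site d) :
    clusterWithin Λ ω x ⊆ insert x ↑Λ := by
  intro y hy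
  obtain ⟨p⟩ := (show (openGraph _).Reachable x y from hy)
  cases hp : p.reverse with
  | nil => exact Set.mem_insert _ _
  | cons h _ =>
    rw [openGraph_adj] at h
    have he := (Finset.mem_coe.1 h.1.2)
    rw [mem_edgesIn_iff] at he
    exact Set.mem_insert_of_mem _ (he.2 y (Sym2.mem_mk_left _ _))

/-- `clusterWithin` is monotone in `Λ`. [folklore] -/
theorem clusterWithin_mono {Λ Λ' : Finset (Site d)} (h : Λ' ⊆ Λ) (ω : Set (Sym2 (Site d)))
    (x : Site d) : clusterWithin Λ' ω x ⊆ clusterWithin Λ ω x := by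
  refine openCluster_mono (Set.inter_subset_inter_right _ fun e he => ?_) x
  rw [Finset.mem_coe, mem_edgesIn_iff] at he ⊢
  exact ⟨he.1, fun z hz => h (he.2 z hz)⟩

/-- **`{C^Λ_x = S} = innerConnFrom S x ∩ bdClosed Λ S`** for `x ∈ S ⊆ Λ`: the cluster is `S` iff `S`
is internally connected from `x` and no boundary edge of `S` is open (the first exit edge of an
open path leaving `S` would be an open boundary edge). [folklore] -/
theorem clusterEq_eq_inter {Λ S : Finset (Site d)} {x : Site d} (hx : x ∈ S) (hS : S ⊆ Λ) :
    clusterEq Λ S x = innerConnFrom S x ∩ bdClosed Λ S := by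
  ext ω
  constructor
  · intro hω
    have hC : clusterWithin Λ ω x = ↑S := hω
    constructor
    · -- every vertex of `S` is reached inside `S`
      intro v hv
      have hv' : v ∈ clusterWithin Λ ω x := by rw [hC]; exact hv
      obtain ⟨p⟩ := (show (openGraph _).Reachable x v from hv')
      -- all vertices of `p` lie in the cluster `S`
      have hsupp : ∀ u ∈ p.support, u ∈ (↑S : Set (Site d)) := fun u hu => by
        rw [← hC]; exact ⟨p.takeUntil u hu⟩
      have hedges : ∀ e ∈ p.edges, e ∈ (openGraph (ω ∩ ↑(edgesIn (zdGraph d) S))).edgeSet := by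
        intro e he
        induction e using Sym2.ind with
        | _ a b =>
          have hadj := p.adj_of_mem_edges he
          rw [openGraph_adj] at hadj
          rw [SimpleGraph.mem_edgeSet, openGraph_adj]
          refine ⟨⟨hadj.1.1, ?_⟩, hadj.2⟩
          have he' := Finset.mem_coe.1 hadj.1.2
          rw [mem_edgesIn_iff] at he'
          rw [Finset.mem_coe, mem_edgesIn_iff]
          refine ⟨he'.1, fun z hz => ?_⟩
          rcases Sym2.mem_iff.1 hz with rfl | rfl
          · exact hsupp _ (p.fst_mem_support_of_mem_edges he)
          · exact hsupp _ (p.snd_mem_support_of_mem_edges he)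
      exact ⟨p.transfer _ hedges⟩
    · -- no boundary edge is open
      intro e he heω
      induction e using Sym2.ind with
      | _ a b =>
        rw [mem_bdEdges_iff] at he
        have hab : (openGraph (ω ∩ ↑(edgesIn (zdGraph d) Λ))).Adj a b := by
          rw [openGraph_adj]
          refine ⟨⟨heω, ?_⟩, he.1.ne⟩
          rw [Finset.mem_coe, mem_edgesIn_iff]
          refine ⟨(SimpleGraph.mem_edgeSet _).2 he.1, fun z hz => ?_⟩
          rcases Sym2.mem_iff.1 hz with rfl | rfl
          · rcases he.2 with h | h
            · exact hS h.1
            · exact h.2.1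
          · rcases he.2 with h | h
            · exact h.2.1
            · exact hS h.1
        rcases he.2 with ⟨ha, -, hbS⟩ | ⟨hb, -, haS⟩
        · have : b ∈ clusterWithin Λ ω x := by
            have ha' : a ∈ clusterWithin Λ ω x := by rw [hC]; exact ha
            exact ha'.trans ⟨SimpleGraph.Walk.cons hab .nil⟩
          rw [hC] at this
          exact hbS this
        · have : a ∈ clusterWithin Λ ω x := by
            have hb' : b ∈ clusterWithin Λ ω x := by rw [hC]; exact hb
            exact hb'.trans ⟨SimpleGraph.Walk.cons hab.symm .nil⟩
          rw [hC] at this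
          exact haS this
  · rintro ⟨hin, hbd⟩
    apply Set.Subset.antisymm
    · -- an open path cannot leave `S`: its first exit edge would be an open boundary edge
      intro v hv
      by_contra hvS
      obtain ⟨p⟩ := (show (openGraph _).Reachable x v from hv)
      obtain ⟨e, -, heS, heS'⟩ := p.exists_boundary_dart (↑S) hx hvS
      have hadj := e.adj
      rw [openGraph_adj] at hadj
      have he' := Finset.mem_coe.1 hadj.1.2
      rw [mem_edgesIn_iff] at he'
      refine hbd s(e.fst, e.snd) ?_ hadj.1.1
      rw [mem_bdEdges_iff]
      exact ⟨(SimpleGraph.mem_edgeSet _).1 he'.1, Or.inl ⟨heS, he'.2 _ (Sym2.mem_mk_right _ _), heS'⟩⟩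
    · refine hin.trans (openCluster_mono (Set.inter_subset_inter_right _ fun e he => ?_) x)
      rw [Finset.mem_coe, mem_edgesIn_iff] at he ⊢
      exact ⟨he.1, fun z hz => hS (he.2 z hz)⟩

/-! ### Cylinder structure and probabilities -/

/-- `innerConnFrom S x` is determined by the edges inside `S`. [folklore] -/
theorem determinedBy_innerConnFrom (S : Finset (Site d)) (x : Site d) :
    DeterminedBy (innerConnFrom S x) ↑(edgesIn (zdGraph d) S) := by
  rw [determinedBy_iff]
  intro ω ω' h
  simp only [innerConnFrom, Set.mem_setOf_eq, h]

/-- `bdClosed Λ S` is determined by the boundary edges. [folklore] -/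
theorem determinedBy_bdClosed (Λ S : Finset (Site d)) :
    DeterminedBy (bdClosed Λ S) ↑(bdEdges Λ S) := by
  rw [determinedBy_iff]
  intro ω ω' h
  simp only [bdClosed, Set.mem_setOf_eq]
  refine forall₂_congr fun e he => ?_
  have := Set.ext_iff.1 h e
  simp only [Set.mem_inter_iff, Finset.mem_coe, he, and_true] at this
  rw [this]

/-- `connWithin Λ x y` is determined by the edges inside `Λ`. [folklore] -/
theorem determinedBy_connWithin (Λ : Finset (Site d)) (x y : Site d) :
    DeterminedBy (connWithin Λ x y) ↑(edgesIn (zdGraph d) Λ) := by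
  rw [determinedBy_iff]
  intro ω ω' h
  simp only [connWithin, clusterWithin, Set.mem_setOf_eq, h]

/-- `clusterEq Λ S x` is determined by the edges inside `Λ`. [folklore] -/
theorem determinedBy_clusterEq (Λ S : Finset (Site d)) (x : Site d) :
    DeterminedBy (clusterEq Λ S x) ↑(edgesIn (zdGraph d) Λ) := by
  rw [determinedBy_iff]
  intro ω ω' h
  simp only [clusterEq, clusterWithin, Set.mem_setOf_eq, h]

/-- **`P(C^Λ_x = S) = P(innerConnFrom S x) · ∏_{e ∈ ∂S} (1 - p_e)`** for `x ∈ S ⊆ Λ` under any product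
measure (the two factors depend on disjoint sets of edges). [folklore] -/
theorem prodBernoulli_real_clusterEq (p : Sym2 (Site d) → unitInterval) {Λ S : Finset (Site d)}
    {x : Site d} (hx : x ∈ S) (hS : S ⊆ Λ) :
    (prodBernoulli p).real (clusterEq Λ S x) =
      (prodBernoulli p).real (innerConnFrom S x) * ∏ e ∈ bdEdges Λ S, (1 - (p e : ℝ)) := by
  rw [clusterEq_eq_inter hx hS, prodBernoulli_real_inter_of_determinedBy_disjoint p
    (disjoint_edgesIn_bdEdges Λ S) (determinedBy_innerConnFrom S x) (determinedBy_bdClosed Λ S)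
    (determinedBy_innerConnFrom S x).measurableSet_of_finset
    (determinedBy_bdClosed Λ S).measurableSet_of_finset]
  congr 1
  exact prodBernoulli_real_forall_notMem p (bdEdges Λ S)

/-- The inner-connection probability is invariant under flipping the sign of the field on `S`
(the weights of the edges inside `S` are unchanged). [cite: Lupu2016, proof of Prop. 4.2] -/
theorem prodBernoulli_real_innerConnFrom_setFlip (S : Finset (Site d)) (ψ : Site d → ℝ) (x : Site d) :
    (prodBernoulli (symWeight (setFlip S ψ))).real (innerConnFrom S x) =
      (prodBernoulli (symWeight ψ)).real (innerConnFrom S x) := by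
  refine prodBernoulli_real_eq_of_determinedBy _ _ (fun e he => ?_) (determinedBy_innerConnFrom S x)
    (determinedBy_innerConnFrom S x).measurableSet_of_finset
  induction e using Sym2.ind with
  | _ a b =>
    rw [Finset.mem_coe, mem_edgesIn_iff] at he
    exact symWeight_setFlip_of_iff S ψ
      ⟨fun _ => he.2 b (Sym2.mem_mk_right a b), fun _ => he.2 a (Sym2.mem_mk_left a b)⟩

/-- **Flipping a cluster** (finite volume): for `x ∈ S ⊆ Λ` and `ψ` vanishing off `Λ`,
`P_{R_S ψ}(C^Λ_x = S) · exp(-2 flipExponent S ψ) = P_ψ(C^Λ_x = S)`. Together with the Gaussian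
change of variables under `ψ ↦ R_S ψ` (`integral_comp_setFlip`) this says that the law of
`(ψ, ω)` restricted to `{C_x = S}` is invariant under flipping the sign of `ψ` on `S` — the
finite-volume content of Lupu's Thm. 1 bis ("conditional on the clusters, the signs are i.i.d.
fair coins", proof of Prop. 4.2). [cite: Lupu2016, Thm. 1 bis and proof of Prop. 4.2] -/
theorem prodBernoulli_real_clusterEq_setFlip_mul_exp {Λ S : Finset (Site d)} {x : Site d}
    (hx : x ∈ S) (hS : S ⊆ Λ) {ψ : Site d → ℝ} (hψ : ∀ v ∉ Λ, ψ v = 0) :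
    (prodBernoulli (symWeight (setFlip S ψ))).real (clusterEq Λ S x) *
        Real.exp (-2 * flipExponent S ψ) =
      (prodBernoulli (symWeight ψ)).real (clusterEq Λ S x) := by
  rw [prodBernoulli_real_clusterEq _ hx hS, prodBernoulli_real_clusterEq _ hx hS,
    prodBernoulli_real_innerConnFrom_setFlip, mul_assoc, prod_one_sub_symWeight_setFlip_mul_exp hψ]

end Literature.Probability.LatticeModels
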